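import Summits.CriticalPhenomena.PercolationContinuityZ3.Theorems.Transplant.FKConnectivityAllQAntipodalRootForm3BasePar
import HarnessLib

/-!
# Connectivity correlation inequalities for `φ_{w,q}` — ROOT-FORM CALCULUS, file 73b: GENERATOR LINKS for the GLUE(2,1)∥ certificate — the E₁-side
# families of `Cert3` are the integrands of the tree's two-special facts

Support file (`--supports stmt-CriticalPhenomena-4575`), FK sub-lane `prim-bschramm-fk-2` (gen 31); builds on p205010 (kernel theorem, internal audit
signed; external expert review pending).  No definitions, no named facts, no sorries.  Memo FROM-fk-2-g31-DUALITY.md §8 step (5).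
For a two-special datum `e : EDat` with local type `τ = Base3.ptype e` and base level `Λ_∅ = e.d0.lam`:
* `slot1_link` / `slot0_link` — `e.slot1 K = Cert3.mv1 τ (K − Λ_∅)`, `e.slot0 K = Cert3.mv0 τ (K − Λ_∅)` (F1 = the nested maj₃ root functional, file 61a);
* `par_slot1_link` / `par_slot0_link` — `(e.par b).slot1 K = Cert3.pv1 τ b (K − Λ_∅)` (F2: the parallel transform at `g`-state `b`);
* `acon_link` — `(Base3.dq e Q).acon K = Cert3.con τ Q (K − Λ_∅)` (F4 and the contracted pivots Ucon);
* `exd_link` — `(Base3.dq e Q).r1 K − (Base3.dq e Q).r2 K = Cert3.exd τ Q (K − Λ_∅)` (the exact-level root-U family Uex).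
So every E₁-side column of the certificate table (72a `E21`) is the integrand of a hypothesis of the abstract gluing theorem (73c), exactly as 61e's
`a1_link`…`r2_link` serve THEOREM G27.
[folklore]
-/

noncomputable section

namespace Summit.CriticalPhenomena.PercolationContinuityZ3.Theorems

namespace FK

namespace RootForm

namespace Base3

open Finset Base Gen

variable (e : EDat)

/-- `a1` of a pattern datum in certificate form. [folklore] -/
theorem a1_dq_link (Q : Fin 4) (K : ℤ) :
    (dq e Q).a1 K = ((Cert.I ((ptype e).dL Q + Cert.bi ((ptype e).K1 Q) ≤ K - e.d0.lam) : ℤ) : ℝ) := by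
  unfold PDat.a1; refine Base.ind_eq_cast ?_
  rw [dL_ptype, K1_ptype, Base.bi_eq_bit]; omega
/-- `a2` of a pattern datum in certificate form. [folklore] -/
theorem a2_dq_link (Q : Fin 4) (K : ℤ) :
    (dq e Q).a2 K = ((Cert.I ((ptype e).dL Q + Cert.bi ((ptype e).K2 Q) ≤ K - e.d0.lam) : ℤ) : ℝ) := by
  unfold PDat.a2; refine Base.ind_eq_cast ?_
  rw [dL_ptype, K2_ptype, Base.bi_eq_bit]; omega
/-- `r1` of a pattern datum in certificate form. [folklore] -/
theorem r1_dq_link (Q : Fin 4) (K : ℤ) :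
    (dq e Q).r1 K = ((Cert.bi ((ptype e).K1 Q) * Cert.I ((ptype e).dL Q = K - e.d0.lam) : ℤ) : ℝ) := by
  unfold PDat.r1; rw [mul_comm, K1_ptype]
  exact Base.ind_and_eq_cast (by rw [dL_ptype]; omega) _
/-- `r2` of a pattern datum in certificate form. [folklore] -/
theorem r2_dq_link (Q : Fin 4) (K : ℤ) :
    (dq e Q).r2 K = ((Cert.bi ((ptype e).K2 Q) * Cert.I ((ptype e).dL Q = K - e.d0.lam) : ℤ) : ℝ) := by
  unfold PDat.r2; rw [mul_comm, K2_ptype]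
  exact Base.ind_and_eq_cast (by rw [dL_ptype]; omega) _
/-- `acon` of a pattern datum in certificate form (**F4 / Ucon link**). [folklore] -/
theorem acon_link (Q : Fin 4) (K : ℤ) : (dq e Q).acon K = ((Cert3.con (ptype e) Q (K - e.d0.lam) : ℤ) : ℝ) := by
  unfold PDat.acon Cert3.con; refine Base.ind_eq_cast ?_
  rw [dL_ptype, K1_ptype, K2_ptype, Base.bi_eq_bit, Base.bi_eq_bit]; omega
/-- the exact-level root-exchange difference in certificate form (**Uex link**). [folklore] -/
theorem exd_link (Q : Fin 4) (K : ℤ) : (dq e Q).r1 K - (dq e Q).r2 K = ((Cert3.exd (ptype e) Q (K - e.d0.lam) : ℤ) : ℝ) := by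
  rw [r1_dq_link, r2_dq_link, Cert3.exd]; push_cast; ring

/-- **F1 link, slot 1**: the slot-1 integrand of the nested maj₃ root functional is `Cert3.mv1`. [folklore] -/
theorem slot1_link (K : ℤ) : e.slot1 K = ((Cert3.mv1 (ptype e) (K - e.d0.lam) : ℤ) : ℝ) := by
  have A0 := a1_dq_link e 0 K; have A3 := a1_dq_link e 3 K; have R1 := r1_dq_link e 1 K; have R2 := r1_dq_link e 2 K
  simp only [dq] at A0 A3 R1 R2
  unfold EDat.slot1
  rw [A0, A3, R1, R2, Cert3.mv1]
  push_cast; ring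
/-- **F1 link, slot 0.** [folklore] -/
theorem slot0_link (K : ℤ) : e.slot0 K = ((Cert3.mv0 (ptype e) (K - e.d0.lam) : ℤ) : ℝ) := by
  have A0 := a2_dq_link e 0 K; have A3 := a2_dq_link e 3 K; have R1 := r2_dq_link e 1 K; have R2 := r2_dq_link e 2 K
  simp only [dq] at A0 A3 R1 R2
  unfold EDat.slot0
  rw [A0, A3, R1, R2, Cert3.mv0]
  push_cast; ring

/-- pattern data of `g ∥ E₁` at `g`-state `b`: `a1` in certificate form. [folklore] -/
theorem a1_par_dq_link (b : Bool) (Q : Fin 4) (K : ℤ) : ((dq e Q).par b).a1 K =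
    ((Cert.I ((ptype e).dL Q + Cert.bi (if b then (ptype e).K1 Q else (ptype e).K2 Q) + Cert.bi (b || (ptype e).K1 Q) ≤ K - e.d0.lam) : ℤ) : ℝ) := by
  unfold PDat.a1; refine Base.ind_eq_cast ?_
  rw [dL_ptype, K1_ptype, K2_ptype]
  generalize dq e Q = a
  obtain ⟨l, k1, k2⟩ := a
  cases b <;> cases k1 <;> cases k2 <;> simp [PDat.par, Cert.bi, bit] <;> omega
/-- pattern data of `g ∥ E₁` at `g`-state `b`: `a2` in certificate form. [folklore] -/
theorem a2_par_dq_link (b : Bool) (Q : Fin 4) (K : ℤ) : ((dq e Q).par b).a2 K =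
    ((Cert.I ((ptype e).dL Q + Cert.bi (if b then (ptype e).K1 Q else (ptype e).K2 Q) + Cert.bi (!b || (ptype e).K2 Q) ≤ K - e.d0.lam) : ℤ) : ℝ) := by
  unfold PDat.a2; refine Base.ind_eq_cast ?_
  rw [dL_ptype, K1_ptype, K2_ptype]
  generalize dq e Q = a
  obtain ⟨l, k1, k2⟩ := a
  cases b <;> cases k1 <;> cases k2 <;> simp [PDat.par, Cert.bi, bit] <;> omega
/-- pattern data of `g ∥ E₁` at `g`-state `b`: `r1` in certificate form. [folklore] -/
theorem r1_par_dq_link (b : Bool) (Q : Fin 4) (K : ℤ) : ((dq e Q).par b).r1 K =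
    ((Cert.bi (b || (ptype e).K1 Q) * Cert.I ((ptype e).dL Q + Cert.bi (if b then (ptype e).K1 Q else (ptype e).K2 Q) = K - e.d0.lam) : ℤ) : ℝ) := by
  rw [mul_comm, dL_ptype, K1_ptype, K2_ptype]
  generalize dq e Q = a
  obtain ⟨l, k1, k2⟩ := a
  have hb : (PDat.par b ⟨l, k1, k2⟩).k1 = (b || k1) := rfl
  unfold PDat.r1; rw [hb]
  refine Base.ind_and_eq_cast ?_ _
  cases b <;> cases k1 <;> cases k2 <;> simp [PDat.par, Cert.bi, bit] <;> omega
/-- pattern data of `g ∥ E₁` at `g`-state `b`: `r2` in certificate form. [folklore] -/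
theorem r2_par_dq_link (b : Bool) (Q : Fin 4) (K : ℤ) : ((dq e Q).par b).r2 K =
    ((Cert.bi (!b || (ptype e).K2 Q) * Cert.I ((ptype e).dL Q + Cert.bi (if b then (ptype e).K1 Q else (ptype e).K2 Q) = K - e.d0.lam) : ℤ) : ℝ) := by
  rw [mul_comm, dL_ptype, K1_ptype, K2_ptype]
  generalize dq e Q = a
  obtain ⟨l, k1, k2⟩ := a
  have hb : (PDat.par b ⟨l, k1, k2⟩).k2 = (!b || k2) := rfl
  unfold PDat.r2; rw [hb]
  refine Base.ind_and_eq_cast ?_ _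
  cases b <;> cases k1 <;> cases k2 <;> simp [PDat.par, Cert.bi, bit] <;> omega

/-- **F2 link, slot 1**: the slot-1 integrand of `g ∥ E₁` at `g`-state `b` is `Cert3.pv1 τ b`. [folklore] -/
theorem par_slot1_link (b : Bool) (K : ℤ) : (e.par b).slot1 K = ((Cert3.pv1 (ptype e) b (K - e.d0.lam) : ℤ) : ℝ) := by
  have A0 := a1_par_dq_link e b 0 K; have A3 := a1_par_dq_link e b 3 K; have R1 := r1_par_dq_link e b 1 K; have R2 := r1_par_dq_link e b 2 K
  simp only [dq] at A0 A3 R1 R2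
  unfold EDat.slot1 EDat.par
  rw [A0, A3, R1, R2, Cert3.pv1]
  push_cast; ring
/-- **F2 link, slot 0.** [folklore] -/
theorem par_slot0_link (b : Bool) (K : ℤ) : (e.par b).slot0 K = ((Cert3.pv0 (ptype e) b (K - e.d0.lam) : ℤ) : ℝ) := by
  have A0 := a2_par_dq_link e b 0 K; have A3 := a2_par_dq_link e b 3 K; have R1 := r2_par_dq_link e b 1 K; have R2 := r2_par_dq_link e b 2 K
  simp only [dq] at A0 A3 R1 R2
  unfold EDat.slot0 EDat.par
  rw [A0, A3, R1, R2, Cert3.pv0]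
  push_cast; ring

/-- **F4 link**: the contracted AND integrand. [folklore] -/
theorem andCon_link (K : ℤ) : e.andCon K = ((Cert3.con (ptype e) 0 (K - e.d0.lam) - Cert3.con (ptype e) 3 (K - e.d0.lam) : ℤ) : ℝ) := by
  have A0 := acon_link e 0 K; have A3 := acon_link e 3 K
  simp only [dq] at A0 A3
  unfold EDat.andCon
  rw [A0, A3]; push_cast; ring

end Base3

end RootForm

end FK

end Summit.CriticalPhenomena.PercolationContinuityZ3.Theorems

end
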